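import Summits.AtomisticToContinuum.FouriersLaw.Theorems.EmbeddedDrudeMourreDrudeDissolutionReduction
import Summits.AtomisticToContinuum.FouriersLaw.Theorems.EmbeddedDrudeMourreMourreDissolutionFrameworkReduction
import Summits.AtomisticToContinuum.FouriersLaw.Theorems.EmbeddedDrudeMourreFGRGap
import Literature.MathematicalPhysics.KineticTheory.InfiniteChainAbelWitness
import HarnessLib

/-!
# `DrudeDissolution` REDUCED to (H), the Fermi-golden-rule positivity of the plateau and integrable decay
# of the current autocorrelation (`--supports` stmt-AtomisticToContinuum-12593; line `Sketch`, lead rev 5)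

Sequel of `…DrudeDissolutionReduction.lean` (rev 3: `DrudeDissolution ⇐ (F) ∧ (K)`) and
`…DrudeDissolutionReductionClustering.lean` (rev 4: `(H) ⇒ (F)`, `DrudeDissolution ⇐ (H) ∧ (K)`). Rev 5
splits the kinetic Green–Kubo statement (K) = "`C_T ∈ L¹(0,∞)` and `0 < ∫₀^∞ C_T` on a corner, for every
canonical zero-wavenumber datum" along its two halves:

* the POSITIVITY half is supplied by Stub 7 `stub_fgrPositivity` of the sibling crux `MourreDissolution`
  (stmt-AtomisticToContinuum-12594, line separable-vertex-faddeev-pair-sector), taken VERBATIM as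
  hypothesis (P): under `HasOddSectorGap ω₂ lam β` — discharged here by the PROVED crux `FGRGap`
  (`Theorems.FGRGap_proof`) — and `T < T₀`, for every symmetric canonical datum the Abel functional
  `∫₀^∞ e^{−νt} C_T(t) dt` is `≥ c > 0` for all small `ν > 0`; with `C_T ∈ L¹` this gives `c ≤ ∫₀^∞ C_T`
  by Abel summation (`le_setIntegral_of_abel_floor`, from the tree's `tendsto_abel_of_integrableOn`);
* the `L¹` half becomes hypothesis (I) = `stub_integrableDecay`: on a corner, for every canonical datum
  `(D, Z)` (carrier `bmGood`) with DLR, superstable, momentum-reversal-symmetric state and strongly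
  continuous Koopman group, `C_T ∈ L¹(0, ∞)` — the time-domain core of line `Sketch` (open).

Main theorem: `drudeDissolution_of_gibbsClustering_of_fgrPositivity_of_integrableDecay :
(H) → (P) → (I) → DrudeDissolution`, all three hypotheses being registered stub signatures verbatim; the
symmetric framework comes from (H) by `Theorems.MourreDissolution.symmetricFramework_of_clustering`, the
regularity of `C_T` from `regular_of_zeroWavenumberData`, the spectral measure from the landed Bochner stub
and the window from the landed integrable-spectral criterion.
-/

noncomputable section

open MeasureTheory Filter Set
open scoped Topology

namespace Summit.AtomisticToContinuum.FouriersLaw.Theorems.DrudeDissolution.LineSketch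

open Literature.MathematicalPhysics.KineticTheory.HeatConduction

/-- **Abel floor + `L¹` ⇒ a floor for the integral.** If `C ∈ L¹(0,∞)` and
`c ≤ ∫₀^∞ e^{−νt} C(t) dt` for all `ν ∈ (0, ν₀)`, then `c ≤ ∫₀^∞ C` (Abel summation of an `L¹` function,
`tendsto_abel_of_integrableOn`, and `ge_of_tendsto` along `𝓝[>] 0`). [folklore] -/
theorem le_setIntegral_of_abel_floor {C : ℝ → ℝ} (hC : IntegrableOn C (Set.Ioi 0)) {c ν₀ : ℝ}
    (hν₀ : 0 < ν₀)
    (h : ∀ ν : ℝ, 0 < ν → ν < ν₀ → c ≤ ∫ t in Set.Ioi (0 : ℝ), Real.exp (-(ν * t)) * C t) :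
    c ≤ ∫ t in Set.Ioi (0 : ℝ), C t := by
  refine ge_of_tendsto (tendsto_abel_of_integrableOn hC) ?_
  filter_upwards [Ioo_mem_nhdsGT hν₀] with ν hν
  exact h ν hν.1 hν.2

/-- **Positive Green–Kubo integral from an Abel floor** (registered anchor sub-goal of this file):
`C ∈ L¹(0,∞)` with Abel functional `≥ c > 0` for all `ν ∈ (0, ν₀)` has `0 < ∫₀^∞ C`. [folklore] -/
theorem setIntegral_pos_of_abel_floor :
    ∀ (C : ℝ → ℝ), MeasureTheory.IntegrableOn C (Set.Ioi 0) → ∀ (c ν₀ : ℝ), 0 < c → 0 < ν₀ →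
      (∀ ν : ℝ, 0 < ν → ν < ν₀ → c ≤ MeasureTheory.integral (MeasureTheory.volume.restrict (Set.Ioi (0:ℝ)))
        (fun t : ℝ => Real.exp (-(ν * t)) * C t)) →
      0 < MeasureTheory.integral (MeasureTheory.volume.restrict (Set.Ioi (0:ℝ))) (fun t : ℝ => C t) :=
  fun _C hC _c _ν₀ hc hν₀ h => lt_of_lt_of_le hc (le_setIntegral_of_abel_floor hC hν₀ h)

/-- **`DrudeDissolution ⇐ (H) ∧ (P) ∧ (I)`** (the checked composition of line `Sketch`, rev 5
(its signature exceeds the 4000-character registration limit, so the registered anchor of this file is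
`setIntegral_pos_of_abel_floor`), with its three open stubs as explicit hypotheses — (H) is
`stub_gibbsClustering` and (P) is `stub_fgrPositivity`, both verbatim the stubs registered on the sibling
crux stmt-12594, and (I) is `stub_integrableDecay`): the shared Gibbs/clustering infrastructure, the
Fermi-golden-rule positivity of the plateau (its gap hypothesis discharged by `FGRGap_proof`) and
integrable decay of `C_T` on a corner together imply the dissolved Drude atom, with threshold
`T₀ := min(T₀^{(I)}, T₀^{(P)})` and witness `(Z.μ, D)` from the symmetric framework of (H). [folklore] -/
theorem drudeDissolution_of_gibbsClustering_of_fgrPositivity_of_integrableDecay :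
    (∀ ω₂ lam β γ : ℝ, 0 < ω₂ → 0 < lam → 0 < β → ∀ T : ℝ, 0 < T →
      ∀ D : Literature.MathematicalPhysics.KineticTheory.HeatConduction.InfiniteChainDynamics (Literature.MathematicalPhysics.KineticTheory.HeatConduction.pinnedChain ω₂ lam β γ),
      D.carrier = (Literature.MathematicalPhysics.KineticTheory.HeatConduction.pinnedChain ω₂ lam β γ).bmGood → (∀ t : ℝ, Measurable (D.flow t)) →
      (∀ t : ℝ, ∀ σ ∉ (Literature.MathematicalPhysics.KineticTheory.HeatConduction.pinnedChain ω₂ lam β γ).bmGood, D.flow t σ = σ) →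
      ∃ μ : MeasureTheory.Measure (ℤ → ℝ × ℝ),
      (Literature.MathematicalPhysics.KineticTheory.HeatConduction.pinnedChain ω₂ lam β γ).IsChainGibbsMeasure T μ ∧ Literature.MathematicalPhysics.KineticTheory.HeatConduction.IsShiftInvariant μ ∧
      (Literature.MathematicalPhysics.KineticTheory.HeatConduction.pinnedChain ω₂ lam β γ).HasSuperstabilityEstimate μ ∧
      μ.map (fun (σ : ℤ → ℝ × ℝ) (x : ℤ) => σ (-x)) = μ ∧
      (∀ a ∈ ({fun σ => (Literature.MathematicalPhysics.KineticTheory.HeatConduction.pinnedChain ω₂ lam β γ).bondCurrentZ σ 0,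
      fun σ => (Literature.MathematicalPhysics.KineticTheory.HeatConduction.pinnedChain ω₂ lam β γ).energyDensityZ σ 0} : Set ((ℤ → ℝ × ℝ) → ℝ)),
      ∀ b ∈ ({fun σ => (Literature.MathematicalPhysics.KineticTheory.HeatConduction.pinnedChain ω₂ lam β γ).bondCurrentZ σ 0,
      fun σ => (Literature.MathematicalPhysics.KineticTheory.HeatConduction.pinnedChain ω₂ lam β γ).energyDensityZ σ 0} : Set ((ℤ → ℝ × ℝ) → ℝ)),
      ∀ u : ℝ, Summable fun x : ℤ =>
      ProbabilityTheory.covariance a ((b ∘ Literature.MathematicalPhysics.KineticTheory.HeatConduction.chainShift x) ∘ D.flow u) μ) ∧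
      (∀ a ∈ ({fun σ => (Literature.MathematicalPhysics.KineticTheory.HeatConduction.pinnedChain ω₂ lam β γ).bondCurrentZ σ 0,
      fun σ => (Literature.MathematicalPhysics.KineticTheory.HeatConduction.pinnedChain ω₂ lam β γ).energyDensityZ σ 0} : Set ((ℤ → ℝ × ℝ) → ℝ)),
      ContinuousAt (fun t : ℝ => ∑' x : ℤ,
      ProbabilityTheory.covariance a ((a ∘ Literature.MathematicalPhysics.KineticTheory.HeatConduction.chainShift x) ∘ D.flow t) μ) 0)) →
    (∀ ω₂ lam β γ : ℝ, 0 < ω₂ → 0 < lam → 0 < β → 0 < γ →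
      Literature.MathematicalPhysics.KineticTheory.PhononBoltzmann.HasOddSectorGap ω₂ lam β →
      ∃ T₀ : ℝ, 0 < T₀ ∧ ∀ T : ℝ, 0 < T → T < T₀ →
      ∀ (D : Literature.MathematicalPhysics.KineticTheory.HeatConduction.InfiniteChainDynamics
      (Literature.MathematicalPhysics.KineticTheory.HeatConduction.pinnedChain ω₂ lam β γ))
      (Z : Literature.MathematicalPhysics.KineticTheory.HeatConduction.ZeroWavenumberData
      (Literature.MathematicalPhysics.KineticTheory.HeatConduction.pinnedChain ω₂ lam β γ) D),
      D.carrier =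
      (Literature.MathematicalPhysics.KineticTheory.HeatConduction.pinnedChain
      ω₂ lam β γ).bmGood →
      (Literature.MathematicalPhysics.KineticTheory.HeatConduction.pinnedChain
      ω₂ lam β γ).IsChainGibbsMeasure T Z.μ →
      (Literature.MathematicalPhysics.KineticTheory.HeatConduction.pinnedChain
      ω₂ lam β γ).HasSuperstabilityEstimate Z.μ →
      Z.HasMomentumReversal →
      (∀ ψ : Literature.MathematicalPhysics.KineticTheory.HeatConduction.ZeroWavenumberSpace Z,
      Continuous fun t : ℝ => Z.koopman t ψ) →
      ∃ c ν₀ : ℝ, 0 < c ∧ 0 < ν₀ ∧ ∀ ν : ℝ, 0 < ν → ν < ν₀ →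
      c ≤ MeasureTheory.integral (MeasureTheory.volume.restrict (Set.Ioi (0:ℝ)))
      (fun t : ℝ => Real.exp (-(ν * t)) * D.currentCorrelation Z.μ t)) →
    (∀ ω₂ lam β γ : ℝ, 0 < ω₂ → 0 < lam → 0 < β → 0 < γ → ∃ T₀ : ℝ, 0 < T₀ ∧
      ∀ T : ℝ, 0 < T → T < T₀ →
        ∀ (D : Literature.MathematicalPhysics.KineticTheory.HeatConduction.InfiniteChainDynamics
              (Literature.MathematicalPhysics.KineticTheory.HeatConduction.pinnedChain ω₂ lam β γ))
          (Z : Literature.MathematicalPhysics.KineticTheory.HeatConduction.ZeroWavenumberData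
              (Literature.MathematicalPhysics.KineticTheory.HeatConduction.pinnedChain ω₂ lam β γ) D),
          D.carrier =
            (Literature.MathematicalPhysics.KineticTheory.HeatConduction.pinnedChain ω₂ lam β γ).bmGood →
          (Literature.MathematicalPhysics.KineticTheory.HeatConduction.pinnedChain
              ω₂ lam β γ).IsChainGibbsMeasure T Z.μ →
          (Literature.MathematicalPhysics.KineticTheory.HeatConduction.pinnedChain
              ω₂ lam β γ).HasSuperstabilityEstimate Z.μ →
          Z.HasMomentumReversal →
          (∀ ψ : Literature.MathematicalPhysics.KineticTheory.HeatConduction.ZeroWavenumberSpace Z,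
            Continuous fun t : ℝ => Z.koopman t ψ) →
          MeasureTheory.IntegrableOn (D.currentCorrelation Z.μ) (Set.Ioi 0)) →
    Summit.AtomisticToContinuum.FouriersLaw.Theses.EmbeddedDrudeMourre.DrudeDissolution := by
  intro hH hF hK ω₂ lam β γ hω hl hβ hγ
  obtain ⟨T₁, hT₁, hK'⟩ := hK ω₂ lam β γ hω hl hβ hγ
  obtain ⟨T₂, hT₂, hF'⟩ := hF ω₂ lam β γ hω hl hβ hγ
    (Summit.AtomisticToContinuum.FouriersLaw.Theorems.FGRGap_proof ω₂ lam β hω hl hβ)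
  obtain ⟨D, hcar, hall⟩ :=
    Summit.AtomisticToContinuum.FouriersLaw.Theorems.MourreDissolution.symmetricFramework_of_clustering
      hH ω₂ lam β γ hω hl hβ hγ
  refine ⟨min T₁ T₂, lt_min hT₁ hT₂, fun T hTpos hTlt => ?_⟩
  obtain ⟨Z, hG, hSS, hRev, -, -, -, hsc⟩ := hall T hTpos
  obtain ⟨hP, hA, hcont, heven, hpsd⟩ := regular_of_zeroWavenumberData Z hG hsc
  have hint : IntegrableOn (D.currentCorrelation Z.μ) (Set.Ioi 0) :=
    hK' T hTpos (lt_of_lt_of_le hTlt (min_le_left _ _)) D Z hcar hG hSS hRev hsc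
  obtain ⟨c, ν₀, hc, hν₀, hfloor⟩ :=
    hF' T hTpos (lt_of_lt_of_le hTlt (min_le_right _ _)) D Z hcar hG hSS hRev hsc
  have hpos : 0 < ∫ t in Set.Ioi (0 : ℝ), D.currentCorrelation Z.μ t :=
    setIntegral_pos_of_abel_floor _ hint c ν₀ hc hν₀ hfloor
  obtain ⟨σ, hσ, hC⟩ := Theorems.MourreDissolution.stub_cosineBochner _ hcont heven hpsd
  obtain ⟨σ', hσ', hC', δ, g, hδ, hg, hg0, hgpos, hres⟩ :=
    stub_integrableSpectralCriterion σ _ hσ hC hint hpos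
  exact ⟨Z.μ, D, hG, hP, hA, σ', hσ', hC', δ, g, hδ, hg, hg0, hgpos, hres⟩

end Summit.AtomisticToContinuum.FouriersLaw.Theorems.DrudeDissolution.LineSketch

end
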